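import Summits.Langlands.Langlands.Theorems.ParityBlindBianchiTwoAdicBianchiProModularityLevelTameLevelMonotone
import HarnessLib

/-!
# `TwoAdicBianchiProModularityLevel` (crux stmt-Langlands-15110, route `ParityBlindBianchi`) —
# stub B may be attacked WITHIN ANY PRESCRIBED SMALL LEVEL (e.g. a neat one)

Consequences of the tame-level monotonicity (`…TameLevelMonotone`) for the shape of the open stub B
(`stub_artinLift` = big `R = 𝕋` for `GL₂/K`, `l₀ = 1`, `p = 2`, read at the Artin point):

* `artinLift_hypothesis_inf` (registered sub-goal) — the HYPOTHESIS block of B (a tame level `U₀` with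
  the three clauses carrying an integral point `b` of `Spf 𝕋(U₀²)` congruent to `a`) at `U₀` implies the
  same block at `U₀ ∩ V` for every open `V` with the third clause: residual occurrence, witnessed by a
  point, persists to every smaller admissible level (companion of `artinLift_conclusion_inf`; no
  Hochschild–Serre / dévissage needed for points, cf. lead c10's residual-support level change);
* `stub_artinLift_iff_within` (registered sub-goal) — for EVERY admissible family of levels
  `V K S₀` (open, third clause; e.g. `V = GL₂(𝒪̂_K) ∩ K_f(4)`, whose arithmetic stabilisers are
  torsion-free, or `K_f(4 λ²)`), **B is equivalent to B restricted to hypothesis levels `U₀ ≤ V K S₀`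
  and conclusion levels `U ≤ U₀`.**  So whoever attacks B may assume from the start that every level in
  sight is inside a fixed neat level (cohomology of manifolds, perfect complexes, no elliptic elements)
  and that the level of the conclusion sits below the level where occurrence is witnessed — exactly the
  setting of the Calegari–Geraghty / Gee–Newton statements [GeeNewton2020, §5.1, Conj. 60, Prop. 62].

Sorry-free, definition-free; lead c11 (line `Sketch`, cycle 12).
-/

noncomputable section

set_option linter.dupNamespace false

namespace Summit.Langlands.Langlands.Theorems.TwoAdicBianchiProModularityLevel

open CategoryTheory Literature.NumberTheory.Automorphic Literature.NumberTheory.GaloisRepresentations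
open scoped NumberField
open IsDedekindDomain

/-! ### The hypothesis block of B is stable under intersecting the level -/

/-- **Residual occurrence witnessed by a point persists to every smaller admissible level** (registered
sub-goal): the hypothesis block of stub B — `U₀` open, `U₀ ≤ GL₂(𝒪̂_K)`, third clause, and an integral
point `b` of `Spf 𝕋(U₀²)` with `‖b − a‖ < 1` at every good place — at `U₀` implies the same block at
`U₀ ∩ V` for every open `V` satisfying the third clause (the same `b`; `crux_isHeckePoint_of_le_tameLevel`).
[cite: ShimuraIATAF1971, Ch. 3, Prop. 3.1] [cite: Brown1982CohomologyGroups, Ch. III, Prop. 10.1] -/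
theorem artinLift_hypothesis_inf : ∀ (K : Type) [Field K] [NumberField K] (S₀ : Finset ℕ), 2 ∈ S₀ →
    ∀ (ϖ : ∀ v : HeightOneSpectrum (𝓞 K), (v.adicCompletion K)ˣ)
      (a : {v : HeightOneSpectrum (𝓞 K) // ∀ ℓ ∈ S₀, ((ℓ : ℕ) : 𝓞 K) ∉ v.asIdeal} → ℕ →
        (PadicAlgCl.valued 2).v.valuationSubring)
      (U₀ V : Subgroup (GL (Fin 2) (FiniteAdeleRing (𝓞 K) K))),
    (IsOpen (U₀ : Set (GL (Fin 2) (FiniteAdeleRing (𝓞 K) K))) ∧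
      U₀ ≤ glFiniteIntegralLevel 2 K ∧
      (∀ g ∈ glFiniteIntegralLevel 2 K,
        (∀ v : HeightOneSpectrum (𝓞 K), ¬ (∀ ℓ ∈ S₀, ((ℓ : ℕ) : 𝓞 K) ∉ v.asIdeal) →
          ∀ i j : Fin 2, ((g : Matrix (Fin 2) (Fin 2) (FiniteAdeleRing (𝓞 K) K)) i j) v =
            (1 : Matrix (Fin 2) (Fin 2) (v.adicCompletion K)) i j) → g ∈ U₀) ∧
      ∃ b : {v : HeightOneSpectrum (𝓞 K) // ∀ ℓ ∈ S₀, ((ℓ : ℕ) : 𝓞 K) ∉ v.asIdeal} → ℕ →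
          (PadicAlgCl.valued 2).v.valuationSubring,
        (∀ j : {v : HeightOneSpectrum (𝓞 K) // ∀ ℓ ∈ S₀, ((ℓ : ℕ) : 𝓞 K) ∉ v.asIdeal} × Fin 2,
          ‖((b j.1 (j.2.val + 1) : (PadicAlgCl.valued 2).v.valuationSubring) : PadicAlgCl 2) -
            ((a j.1 (j.2.val + 1) : (PadicAlgCl.valued 2).v.valuationSubring) : PadicAlgCl 2)‖ < 1) ∧
        IsHeckePoint
          (Matrix.GeneralLinearGroup.map (algebraMap K (FiniteAdeleRing (𝓞 K) K)) :
            GL (Fin 2) K →* GL (Fin 2) (FiniteAdeleRing (𝓞 K) K))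
          (LevelTower.ofSeq U₀ (fun r : ℕ =>
            (principalCongruenceLevel 2 K (Ideal.span {((2 : ℕ) : 𝓞 K)} ^ r)).map (GLn.sndHom 2 K)))
          ((2 : ℕ) : (PadicAlgCl.valued 2).v.valuationSubring)
          (fun j : {v : HeightOneSpectrum (𝓞 K) // ∀ ℓ ∈ S₀, ((ℓ : ℕ) : 𝓞 K) ∉ v.asIdeal} × Fin 2 =>
            GLn.sndHom 2 K (heckeDiagAt 2 K j.1.1 (ϖ j.1.1) (j.2.val + 1)))
          (fun j => b j.1 (j.2.val + 1))) →
    IsOpen (V : Set (GL (Fin 2) (FiniteAdeleRing (𝓞 K) K))) →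
    (∀ g ∈ glFiniteIntegralLevel 2 K,
      (∀ v : HeightOneSpectrum (𝓞 K), ¬ (∀ ℓ ∈ S₀, ((ℓ : ℕ) : 𝓞 K) ∉ v.asIdeal) →
        ∀ i j : Fin 2, ((g : Matrix (Fin 2) (Fin 2) (FiniteAdeleRing (𝓞 K) K)) i j) v =
          (1 : Matrix (Fin 2) (Fin 2) (v.adicCompletion K)) i j) → g ∈ V) →
    (IsOpen (((U₀ ⊓ V : Subgroup (GL (Fin 2) (FiniteAdeleRing (𝓞 K) K))) :
        Set (GL (Fin 2) (FiniteAdeleRing (𝓞 K) K)))) ∧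
      U₀ ⊓ V ≤ glFiniteIntegralLevel 2 K ∧
      (∀ g ∈ glFiniteIntegralLevel 2 K,
        (∀ v : HeightOneSpectrum (𝓞 K), ¬ (∀ ℓ ∈ S₀, ((ℓ : ℕ) : 𝓞 K) ∉ v.asIdeal) →
          ∀ i j : Fin 2, ((g : Matrix (Fin 2) (Fin 2) (FiniteAdeleRing (𝓞 K) K)) i j) v =
            (1 : Matrix (Fin 2) (Fin 2) (v.adicCompletion K)) i j) → g ∈ U₀ ⊓ V) ∧
      ∃ b : {v : HeightOneSpectrum (𝓞 K) // ∀ ℓ ∈ S₀, ((ℓ : ℕ) : 𝓞 K) ∉ v.asIdeal} → ℕ →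
          (PadicAlgCl.valued 2).v.valuationSubring,
        (∀ j : {v : HeightOneSpectrum (𝓞 K) // ∀ ℓ ∈ S₀, ((ℓ : ℕ) : 𝓞 K) ∉ v.asIdeal} × Fin 2,
          ‖((b j.1 (j.2.val + 1) : (PadicAlgCl.valued 2).v.valuationSubring) : PadicAlgCl 2) -
            ((a j.1 (j.2.val + 1) : (PadicAlgCl.valued 2).v.valuationSubring) : PadicAlgCl 2)‖ < 1) ∧
        IsHeckePoint
          (Matrix.GeneralLinearGroup.map (algebraMap K (FiniteAdeleRing (𝓞 K) K)) :
            GL (Fin 2) K →* GL (Fin 2) (FiniteAdeleRing (𝓞 K) K))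
          (LevelTower.ofSeq (U₀ ⊓ V) (fun r : ℕ =>
            (principalCongruenceLevel 2 K (Ideal.span {((2 : ℕ) : 𝓞 K)} ^ r)).map (GLn.sndHom 2 K)))
          ((2 : ℕ) : (PadicAlgCl.valued 2).v.valuationSubring)
          (fun j : {v : HeightOneSpectrum (𝓞 K) // ∀ ℓ ∈ S₀, ((ℓ : ℕ) : 𝓞 K) ∉ v.asIdeal} × Fin 2 =>
            GLn.sndHom 2 K (heckeDiagAt 2 K j.1.1 (ϖ j.1.1) (j.2.val + 1)))
          (fun j => b j.1 (j.2.val + 1))) := by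
  intro K _ _ S₀ h2 ϖ a U₀ V hU₀ hVo hclV
  obtain ⟨hU₀o, hU₀int, hcl₀, b, hcongr, hbpt⟩ := hU₀
  obtain ⟨ho, hint, hcl, hpt⟩ :=
    artinLift_conclusion_inf K S₀ h2 ϖ b U₀ V ⟨hU₀o, hU₀int, hcl₀, hbpt⟩ hVo hclV
  exact ⟨ho, hint, hcl, b, hcongr, hpt⟩

/-! ### B may be attacked within any prescribed small level -/

/-- **Stub B is equivalent to its restriction to small levels** (registered sub-goal).  For every
admissible family of levels `V K S₀ ≤ GL₂(𝔸_K^∞)` — open and containing every integral `g` trivial at the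
bad places (e.g. `GL₂(𝒪̂_K) ∩ K_f(4)`, `K_f(4λ²)`, any neat level of this kind) — the registered stub
`stub_artinLift` (left, VERBATIM) is equivalent to the same statement in which the level `U₀` carrying the
residual occurrence is taken INSIDE `V K S₀` and the level `U` of the conclusion is taken INSIDE `U₀`
(right).  `→`: shrink the conclusion level to `U ∩ U₀` (`artinLift_conclusion_inf`).  `←`: shrink the
hypothesis level to `U₀ ∩ V K S₀` first (`artinLift_hypothesis_inf`).  Reading: B is big `R = 𝕋_𝔪` for
`GL₂/K` at `p = 2` at neat level, the conclusion level below the occurrence level — the literal setting of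
[GeeNewton2020, §5.1]. [cite: GeeNewton2020, §5.1, Def. 59, Conj. 60, Prop. 62]
[cite: ShimuraIATAF1971, Ch. 3, Prop. 3.1] -/
theorem stub_artinLift_iff_within :
    ∀ (V : ∀ (K : Type) [Field K] [NumberField K], Finset ℕ → Subgroup (GL (Fin 2) (FiniteAdeleRing (𝓞 K) K))),
    (∀ (K : Type) [Field K] [NumberField K] (S₀ : Finset ℕ), 2 ∈ S₀ →
      IsOpen (V K S₀ : Set (GL (Fin 2) (FiniteAdeleRing (𝓞 K) K))) ∧
      ∀ g ∈ glFiniteIntegralLevel 2 K,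
        (∀ v : HeightOneSpectrum (𝓞 K), ¬ (∀ ℓ ∈ S₀, ((ℓ : ℕ) : 𝓞 K) ∉ v.asIdeal) →
          ∀ i j : Fin 2, ((g : Matrix (Fin 2) (Fin 2) (FiniteAdeleRing (𝓞 K) K)) i j) v =
            (1 : Matrix (Fin 2) (Fin 2) (v.adicCompletion K)) i j) → g ∈ V K S₀) →
    ((∀ (K : Type) [Field K] [NumberField K], NumberField.IsTotallyComplex K →
    Module.finrank ℚ K = 2 →
    (∃ v w : HeightOneSpectrum (𝓞 K), v ≠ w ∧ ((2 : ℕ) : 𝓞 K) ∈ v.asIdeal ∧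
      ((2 : ℕ) : 𝓞 K) ∈ w.asIdeal) →
    ∀ (σ : FramedGaloisRep K (PadicAlgCl 2) 2),
    Finite σ.toMonoidHom.range → σ.toGaloisRep.IsIrreducible →
    Nonempty ((Matrix.ProjGenLinGroup.mk.comp σ.toMonoidHom).range ≃* alternatingGroup (Fin 5)) →
    ∀ S₀ : Finset ℕ, 2 ∈ S₀ →
    ∀ (ϖ : ∀ v : HeightOneSpectrum (𝓞 K), (v.adicCompletion K)ˣ),
    (∀ v : HeightOneSpectrum (𝓞 K),
      Valued.v ((ϖ v : (v.adicCompletion K)ˣ) : v.adicCompletion K) = WithZero.exp (-1 : ℤ)) →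
    ∀ (a : {v : HeightOneSpectrum (𝓞 K) // ∀ ℓ ∈ S₀, ((ℓ : ℕ) : 𝓞 K) ∉ v.asIdeal} → ℕ →
      (PadicAlgCl.valued 2).v.valuationSubring),
    (∀ (v : HeightOneSpectrum (𝓞 K)) (hv : ∀ ℓ ∈ S₀, ((ℓ : ℕ) : 𝓞 K) ∉ v.asIdeal),
      σ.IsHeckeAssociatedAt v (fun i : ℕ => if i = 0 then (1 : PadicAlgCl 2) else
        ((a ⟨v, hv⟩ i : (PadicAlgCl.valued 2).v.valuationSubring) : PadicAlgCl 2))) →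
    (∃ U₀ : Subgroup (GL (Fin 2) (FiniteAdeleRing (𝓞 K) K)),
      IsOpen (U₀ : Set (GL (Fin 2) (FiniteAdeleRing (𝓞 K) K))) ∧
      U₀ ≤ glFiniteIntegralLevel 2 K ∧
      (∀ g ∈ glFiniteIntegralLevel 2 K,
        (∀ v : HeightOneSpectrum (𝓞 K), ¬ (∀ ℓ ∈ S₀, ((ℓ : ℕ) : 𝓞 K) ∉ v.asIdeal) →
          ∀ i j : Fin 2, ((g : Matrix (Fin 2) (Fin 2) (FiniteAdeleRing (𝓞 K) K)) i j) v =
            (1 : Matrix (Fin 2) (Fin 2) (v.adicCompletion K)) i j) → g ∈ U₀) ∧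
      ∃ b : {v : HeightOneSpectrum (𝓞 K) // ∀ ℓ ∈ S₀, ((ℓ : ℕ) : 𝓞 K) ∉ v.asIdeal} → ℕ →
          (PadicAlgCl.valued 2).v.valuationSubring,
        (∀ j : {v : HeightOneSpectrum (𝓞 K) // ∀ ℓ ∈ S₀, ((ℓ : ℕ) : 𝓞 K) ∉ v.asIdeal} × Fin 2,
          ‖((b j.1 (j.2.val + 1) : (PadicAlgCl.valued 2).v.valuationSubring) : PadicAlgCl 2) -
            ((a j.1 (j.2.val + 1) : (PadicAlgCl.valued 2).v.valuationSubring) : PadicAlgCl 2)‖ < 1) ∧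
        IsHeckePoint
          (Matrix.GeneralLinearGroup.map (algebraMap K (FiniteAdeleRing (𝓞 K) K)) :
            GL (Fin 2) K →* GL (Fin 2) (FiniteAdeleRing (𝓞 K) K))
          (LevelTower.ofSeq U₀ (fun r : ℕ =>
            (principalCongruenceLevel 2 K (Ideal.span {((2 : ℕ) : 𝓞 K)} ^ r)).map (GLn.sndHom 2 K)))
          ((2 : ℕ) : (PadicAlgCl.valued 2).v.valuationSubring)
          (fun j : {v : HeightOneSpectrum (𝓞 K) // ∀ ℓ ∈ S₀, ((ℓ : ℕ) : 𝓞 K) ∉ v.asIdeal} × Fin 2 =>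
            GLn.sndHom 2 K (heckeDiagAt 2 K j.1.1 (ϖ j.1.1) (j.2.val + 1)))
          (fun j => b j.1 (j.2.val + 1))) →
    ∃ U : Subgroup (GL (Fin 2) (FiniteAdeleRing (𝓞 K) K)),
      IsOpen (U : Set (GL (Fin 2) (FiniteAdeleRing (𝓞 K) K))) ∧
      U ≤ glFiniteIntegralLevel 2 K ∧
      (∀ g ∈ glFiniteIntegralLevel 2 K,
        (∀ v : HeightOneSpectrum (𝓞 K), ¬ (∀ ℓ ∈ S₀, ((ℓ : ℕ) : 𝓞 K) ∉ v.asIdeal) →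
          ∀ i j : Fin 2, ((g : Matrix (Fin 2) (Fin 2) (FiniteAdeleRing (𝓞 K) K)) i j) v =
            (1 : Matrix (Fin 2) (Fin 2) (v.adicCompletion K)) i j) → g ∈ U) ∧
      IsHeckePoint
        (Matrix.GeneralLinearGroup.map (algebraMap K (FiniteAdeleRing (𝓞 K) K)) :
          GL (Fin 2) K →* GL (Fin 2) (FiniteAdeleRing (𝓞 K) K))
        (LevelTower.ofSeq U (fun r : ℕ =>
          (principalCongruenceLevel 2 K (Ideal.span {((2 : ℕ) : 𝓞 K)} ^ r)).map (GLn.sndHom 2 K)))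
        ((2 : ℕ) : (PadicAlgCl.valued 2).v.valuationSubring)
        (fun j : {v : HeightOneSpectrum (𝓞 K) // ∀ ℓ ∈ S₀, ((ℓ : ℕ) : 𝓞 K) ∉ v.asIdeal} × Fin 2 =>
          GLn.sndHom 2 K (heckeDiagAt 2 K j.1.1 (ϖ j.1.1) (j.2.val + 1)))
        (fun j => a j.1 (j.2.val + 1))) ↔
    (∀ (K : Type) [Field K] [NumberField K], NumberField.IsTotallyComplex K →
    Module.finrank ℚ K = 2 →
    (∃ v w : HeightOneSpectrum (𝓞 K), v ≠ w ∧ ((2 : ℕ) : 𝓞 K) ∈ v.asIdeal ∧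
      ((2 : ℕ) : 𝓞 K) ∈ w.asIdeal) →
    ∀ (σ : FramedGaloisRep K (PadicAlgCl 2) 2),
    Finite σ.toMonoidHom.range → σ.toGaloisRep.IsIrreducible →
    Nonempty ((Matrix.ProjGenLinGroup.mk.comp σ.toMonoidHom).range ≃* alternatingGroup (Fin 5)) →
    ∀ S₀ : Finset ℕ, 2 ∈ S₀ →
    ∀ (ϖ : ∀ v : HeightOneSpectrum (𝓞 K), (v.adicCompletion K)ˣ),
    (∀ v : HeightOneSpectrum (𝓞 K),
      Valued.v ((ϖ v : (v.adicCompletion K)ˣ) : v.adicCompletion K) = WithZero.exp (-1 : ℤ)) →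
    ∀ (a : {v : HeightOneSpectrum (𝓞 K) // ∀ ℓ ∈ S₀, ((ℓ : ℕ) : 𝓞 K) ∉ v.asIdeal} → ℕ →
      (PadicAlgCl.valued 2).v.valuationSubring),
    (∀ (v : HeightOneSpectrum (𝓞 K)) (hv : ∀ ℓ ∈ S₀, ((ℓ : ℕ) : 𝓞 K) ∉ v.asIdeal),
      σ.IsHeckeAssociatedAt v (fun i : ℕ => if i = 0 then (1 : PadicAlgCl 2) else
        ((a ⟨v, hv⟩ i : (PadicAlgCl.valued 2).v.valuationSubring) : PadicAlgCl 2))) →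
    ∀ U₀ : Subgroup (GL (Fin 2) (FiniteAdeleRing (𝓞 K) K)), U₀ ≤ V K S₀ →
      IsOpen (U₀ : Set (GL (Fin 2) (FiniteAdeleRing (𝓞 K) K))) →
      U₀ ≤ glFiniteIntegralLevel 2 K →
      (∀ g ∈ glFiniteIntegralLevel 2 K,
        (∀ v : HeightOneSpectrum (𝓞 K), ¬ (∀ ℓ ∈ S₀, ((ℓ : ℕ) : 𝓞 K) ∉ v.asIdeal) →
          ∀ i j : Fin 2, ((g : Matrix (Fin 2) (Fin 2) (FiniteAdeleRing (𝓞 K) K)) i j) v =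
            (1 : Matrix (Fin 2) (Fin 2) (v.adicCompletion K)) i j) → g ∈ U₀) →
      ∀ b : {v : HeightOneSpectrum (𝓞 K) // ∀ ℓ ∈ S₀, ((ℓ : ℕ) : 𝓞 K) ∉ v.asIdeal} → ℕ →
          (PadicAlgCl.valued 2).v.valuationSubring,
        (∀ j : {v : HeightOneSpectrum (𝓞 K) // ∀ ℓ ∈ S₀, ((ℓ : ℕ) : 𝓞 K) ∉ v.asIdeal} × Fin 2,
          ‖((b j.1 (j.2.val + 1) : (PadicAlgCl.valued 2).v.valuationSubring) : PadicAlgCl 2) -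
            ((a j.1 (j.2.val + 1) : (PadicAlgCl.valued 2).v.valuationSubring) : PadicAlgCl 2)‖ < 1) →
        IsHeckePoint
          (Matrix.GeneralLinearGroup.map (algebraMap K (FiniteAdeleRing (𝓞 K) K)) :
            GL (Fin 2) K →* GL (Fin 2) (FiniteAdeleRing (𝓞 K) K))
          (LevelTower.ofSeq U₀ (fun r : ℕ =>
            (principalCongruenceLevel 2 K (Ideal.span {((2 : ℕ) : 𝓞 K)} ^ r)).map (GLn.sndHom 2 K)))
          ((2 : ℕ) : (PadicAlgCl.valued 2).v.valuationSubring)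
          (fun j : {v : HeightOneSpectrum (𝓞 K) // ∀ ℓ ∈ S₀, ((ℓ : ℕ) : 𝓞 K) ∉ v.asIdeal} × Fin 2 =>
            GLn.sndHom 2 K (heckeDiagAt 2 K j.1.1 (ϖ j.1.1) (j.2.val + 1)))
          (fun j => b j.1 (j.2.val + 1)) →
    ∃ U : Subgroup (GL (Fin 2) (FiniteAdeleRing (𝓞 K) K)), U ≤ U₀ ∧
      IsOpen (U : Set (GL (Fin 2) (FiniteAdeleRing (𝓞 K) K))) ∧
      U ≤ glFiniteIntegralLevel 2 K ∧
      (∀ g ∈ glFiniteIntegralLevel 2 K,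
        (∀ v : HeightOneSpectrum (𝓞 K), ¬ (∀ ℓ ∈ S₀, ((ℓ : ℕ) : 𝓞 K) ∉ v.asIdeal) →
          ∀ i j : Fin 2, ((g : Matrix (Fin 2) (Fin 2) (FiniteAdeleRing (𝓞 K) K)) i j) v =
            (1 : Matrix (Fin 2) (Fin 2) (v.adicCompletion K)) i j) → g ∈ U) ∧
      IsHeckePoint
        (Matrix.GeneralLinearGroup.map (algebraMap K (FiniteAdeleRing (𝓞 K) K)) :
          GL (Fin 2) K →* GL (Fin 2) (FiniteAdeleRing (𝓞 K) K))
        (LevelTower.ofSeq U (fun r : ℕ =>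
          (principalCongruenceLevel 2 K (Ideal.span {((2 : ℕ) : 𝓞 K)} ^ r)).map (GLn.sndHom 2 K)))
        ((2 : ℕ) : (PadicAlgCl.valued 2).v.valuationSubring)
        (fun j : {v : HeightOneSpectrum (𝓞 K) // ∀ ℓ ∈ S₀, ((ℓ : ℕ) : 𝓞 K) ∉ v.asIdeal} × Fin 2 =>
          GLn.sndHom 2 K (heckeDiagAt 2 K j.1.1 (ϖ j.1.1) (j.2.val + 1)))
        (fun j => a j.1 (j.2.val + 1)))) := by
  intro V hV
  constructor
  · intro hB K _ _ htc hdeg hsplit σ hfin hirr hA5 S₀ h2 ϖ hϖ a hassoc U₀ hU₀V hU₀o hU₀int hcl₀ b hcongr hbpt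
    obtain ⟨U, hUo, hUint, hclU, hpt⟩ := hB K htc hdeg hsplit σ hfin hirr hA5 S₀ h2 ϖ hϖ a hassoc
      ⟨U₀, hU₀o, hU₀int, hcl₀, b, hcongr, hbpt⟩
    obtain ⟨ho, hint, hcl, hpt'⟩ :=
      artinLift_conclusion_inf K S₀ h2 ϖ a U U₀ ⟨hUo, hUint, hclU, hpt⟩ hU₀o hcl₀
    exact ⟨U ⊓ U₀, inf_le_right, ho, hint, hcl, hpt'⟩
  · intro hB K _ _ htc hdeg hsplit σ hfin hirr hA5 S₀ h2 ϖ hϖ a hassoc hocc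
    obtain ⟨U₀, hU₀o, hU₀int, hcl₀, b, hcongr, hbpt⟩ := hocc
    obtain ⟨hVo, hclV⟩ := hV K S₀ h2
    obtain ⟨ho, hint, hcl, b', hcongr', hbpt'⟩ :=
      artinLift_hypothesis_inf K S₀ h2 ϖ a U₀ (V K S₀) ⟨hU₀o, hU₀int, hcl₀, b, hcongr, hbpt⟩ hVo hclV
    obtain ⟨U, -, hUo, hUint, hclU, hpt⟩ := hB K htc hdeg hsplit σ hfin hirr hA5 S₀ h2 ϖ hϖ a hassoc
      (U₀ ⊓ V K S₀) inf_le_right ho hint hcl b' hcongr' hbpt'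
    exact ⟨U, hUo, hUint, hclU, hpt⟩

end Summit.Langlands.Langlands.Theorems.TwoAdicBianchiProModularityLevel

end
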